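import Summits.ResolutionOfSingularities.ResolutionOfSingularities.Theorems.PurelyInseparableDim4JointForestRootNormalised
import Summits.ResolutionOfSingularities.ResolutionOfSingularities.Theorems.PurelyInseparableDim4JointTwoChildrenComputations
import HarnessLib

/-!
# Purely inseparable four-folds: an instance of the monotone joint forest with TWO SEPARATED CHILDREN in one chart —
# `z^p + x₁^p (x₂² − 1)^p x₃ + x₁^{2p} x₄`, `p` odd, is order-reduced by blowing up the 3-fold `V(z, x₁)` and then the two
# disjoint surfaces `{y₁ = 0, y₂ = ±1}` of its exceptional divisor (brick S3 (c) «joint point∘coordinate chains», part 23b,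
# cell `res-dim4-pi`)

[OURS · counted 0] (D-0157 DOOR 2; desk WORD #66 (4)(c), #74 (g), #99 (d); frame `PIDim4.TerminationImpliesOrderReduction`,
S3 (c); host item stmt-ResolutionOfSingularities-16155, helper). Nothing here proves resolution of singularities in
dimension ≥ 4 / characteristic `p` — NOT here, not anywhere in this programme.

`F = x₁^p (x₂² − 1)^p x₃ + x₁^{2p} x₄`, `K = K̄` of characteristic `p ≠ 2`. By part 23a: the closed order-`p` points of `z^p + F`
form the 3-fold `{x₁ = 0}` — ONE initial member `(0, {x₁})`; in the `x₁`-chart the transform `(y₂^{2p} − 1) y₃ + y₁^p y₄` is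
equimultiple exactly where `y₂ = ±1`: the PLAN has TWO entries `(x₁, (0, ±1, 0, 0), {x₁, x₂})` in the SAME chart, SEPARATED at the
coordinate `x₂` (`1 ≠ −1`) — the first kernel instance exercising the separation clause of the forest non-vacuously — with child
equations `(y₂^{2p} ± 2^p y₂^p) y₃ + y₁^p y₄`, over which nothing is equimultiple. Hence, by part 21:

* **`exists_isMarkedResolution_inst₅`** — for `p ≠ 2`, `(𝔸⁵_K, (z^p + x₁^p (x₂² − 1)^p x₃ + x₁^{2p} x₄)·𝒪, [], p)` admits a marked
  resolution (BGMW Def. 3.1.3). UNCONDITIONAL (given `p` odd).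

AI-produced formalisation, weaker than expert review. bears_on: LADDER-RESOLUTION:D157-DOOR2 (res-dim4-pi · S3 (c) joint v2 ·
two-children instance).
-/

set_option linter.dupNamespace false -- D-0017: single-problem summit path `Summit.<S>.<S>.…` by design

noncomputable section

open MvPolynomial Finset CategoryTheory AlgebraicGeometry Opposite TopologicalSpace

namespace Summit.ResolutionOfSingularities.ResolutionOfSingularities.Theorems.PIDim4

open Literature.AlgebraicGeometry.Resolution
open Literature.AlgebraicGeometry.Resolution.Hauser2010
open Literature.AlgebraicGeometry.Resolution.AffinePointBlowup (P A γ coord Wtop ξ)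

namespace Equimultiple

section Instance₅

variable {K : Type} [Field K] {p : ℕ} [hp : Fact p.Prime] [CharP K p]

/-- **`z^p + x₁^p (x₂² − 1)^p x₃ + x₁^{2p} x₄` ADMITS A MARKED RESOLUTION BY A 3-FOLD BLOW-UP FOLLOWED BY TWO DISJOINT SURFACE-CHILD
BLOW-UPS** (`K = K̄` of characteristic `p ≠ 2`): the monotone joint forest (normalised cover) at the root with the one initial member
`(0, {x₁})`, the plan `{x₁} ↦ {(x₁, (0,1,0,0), {x₁,x₂}), (x₁, (0,−1,0,0), {x₁,x₂})}`, `{x₁,x₂} ↦ ∅`, no leaf, no point member.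
[cite: BierstoneGrigorievMilmanWlodarczyk2011, Def. 3.1.3] [cite: HauserPerlega2019PRIMS, §2] [cite: Hauser2010, §F] -/
theorem exists_isMarkedResolution_inst₅ [IsAlgClosed K] [DecidableEq K] (hp2 : p ≠ 2) :
    ∃ (X' : Scheme.{0}) (ρ : X' ⟶ P 4 K) (M' : MarkedIdeal X'),
      IsMarkedResolution (⟨hypSheaf p (X 0 ^ p * (X 1 ^ 2 - 1) ^ p * X 2 + X 0 ^ (2 * p) * X 3 : MvPolynomial (Fin 4) K), [], p⟩ :
        MarkedIdeal (P 4 K)) ρ M' := by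
  classical
  -- `2 ≠ 0` in `K` (characteristic `p ≠ 2`)
  have h2K : (2 : K) ≠ 0 := by
    intro h
    have h' : ((2 : ℕ) : K) = 0 := by exact_mod_cast h
    rw [CharP.cast_eq_zero_iff K p] at h'
    exact hp2 ((Nat.prime_dvd_prime_iff_eq hp.out Nat.prime_two).mp h')
  have hu : ∀ c : K, c * c = 1 → (2 * c) ^ p ≠ 0 := fun c hc =>
    pow_ne_zero _ (mul_ne_zero h2K (fun h0 => by rw [h0, mul_zero] at hc; exact zero_ne_one hc))
  have h1ne : (1 : K) ≠ -1 := fun h => by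
    have : (2 : K) = 0 := by linear_combination h
    exact h2K this
  set F₀ : MvPolynomial (Fin 4) K := X 0 ^ p * (X 1 ^ 2 - 1) ^ p * X 2 + X 0 ^ (2 * p) * X 3 with hF₀
  have hG₀ : deletePthPowers p (PointBlowup.translate (0 : Fin 4 → K) F₀) = F₀ := by
    rw [PointBlowup.translate_zero]
    exact Literature.Barriers.ResolutionOfSingularities.HauserPerlega.deletePthPowers_eq_self isClean_inst₅
  set s₀ : State K := ⟨F₀, 0, ∅⟩ with hs₀
  -- the two entries
  let ent : K → Fin 4 × (Fin 4 → K) × Finset (Fin 4) := fun c =>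
    ((0 : Fin 4), Function.update (0 : Fin 4 → K) 1 c, ({0, 1} : Finset (Fin 4)))
  have hent0 : ∀ c : K, (ent c).2.1 0 = 0 := fun c => by
    show Function.update (0 : Fin 4 → K) 1 c 0 = 0
    rw [Function.update_of_ne (show (0 : Fin 4) ≠ 1 by decide), Pi.zero_apply]
  have hent1 : ∀ c : K, (ent c).2.1 1 = c := fun c => by
    show Function.update (0 : Fin 4 → K) 1 c 1 = c
    rw [Function.update_self]
  have hent_ne : ent 1 ≠ ent (-1) := fun h => by
    have h' := congrArg (fun e : Fin 4 × (Fin 4 → K) × Finset (Fin 4) => e.2.1 1) h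
    simp only [hent1] at h'
    exact h1ne h'
  -- the rules: two planned surface children over the 3-fold, nothing afterwards, no leaves
  let plan : State K → Finset (Fin 4) → Finset (Fin 4 × (Fin 4 → K) × Finset (Fin 4)) := fun _ S =>
    if S = ({0} : Finset (Fin 4)) then {ent 1, ent (-1)} else ∅
  let leaves : State K → Finset (Fin 4) → Finset (Fin 4 × (Fin 4 → K)) := fun _ _ => ∅
  have h01 : ¬ (({0, 1} : Finset (Fin 4)) = {0}) := by decide
  have hplan₀ : ∀ s : State K, plan s {0} = {ent 1, ent (-1)} := fun s => if_pos rfl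
  have hplan₁ : ∀ s : State K, plan s {0, 1} = ∅ := fun s => if_neg h01
  have hleaves : ∀ (s : State K) (S : Finset (Fin 4)), leaves s S = ∅ := fun _ _ => rfl
  have hmem_plan₀ : ∀ (s : State K) {e}, e ∈ plan s {0} → ∃ c : K, c * c = 1 ∧ e = ent c := by
    intro s e he
    rw [hplan₀ s, Finset.mem_insert, Finset.mem_singleton] at he
    rcases he with rfl | rfl
    · exact ⟨1, one_mul 1, rfl⟩
    · exact ⟨-1, by ring, rfl⟩
  -- the states reachable along the plan
  have hreach : ∀ q : State K × Finset (Fin 4),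
      Relation.ReflTransGen (fun q q' : State K × Finset (Fin 4) =>
        ∃ e ∈ plan q.1 q.2, q' = (CentreBlowup.step p q.2 e.1 e.2.1 q.1, e.2.2)) (s₀, {0}) q →
      q = (s₀, {0}) ∨ ∃ c : K, c * c = 1 ∧ q = (CentreBlowup.step p {0} 0 (ent c).2.1 s₀, {0, 1}) := by
    intro q hq
    induction hq with
    | refl => exact Or.inl rfl
    | tail _ hR ih =>
      obtain ⟨e, he, rfl⟩ := hR
      rcases ih with h | ⟨c, hc, h⟩ <;> rw [h] at he ⊢
      · obtain ⟨c, hc, rfl⟩ := hmem_plan₀ s₀ he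
        exact Or.inr ⟨c, hc, rfl⟩
      · rw [hplan₁ (CentreBlowup.step p {0} 0 (ent c).2.1 s₀)] at he
        exact absurd he (Finset.notMem_empty e)
  have hacc₁ : ∀ c : K, Acc (fun q' q : State K × Finset (Fin 4) =>
      ∃ e ∈ plan q.1 q.2, q' = (CentreBlowup.step p q.2 e.1 e.2.1 q.1, e.2.2))
      (CentreBlowup.step p {0} 0 (ent c).2.1 s₀, {0, 1}) := fun c =>
    Acc.intro _ fun q' ⟨e, he, _⟩ => by
      rw [hplan₁ (CentreBlowup.step p {0} 0 (ent c).2.1 s₀)] at he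
      exact absurd he (Finset.notMem_empty e)
  have hacc₀ : Acc (fun q' q : State K × Finset (Fin 4) =>
      ∃ e ∈ plan q.1 q.2, q' = (CentreBlowup.step p q.2 e.1 e.2.1 q.1, e.2.2)) (s₀, {0}) :=
    Acc.intro _ fun q' ⟨e, he, hq'⟩ => by
      obtain ⟨c, -, rfl⟩ := hmem_plan₀ s₀ he
      rw [hq']
      exact hacc₁ c
  refine exists_isMarkedResolution_joint_forest_root_normalised F₀ inst₅_ne_zero isClean_inst₅ plan leaves
    {((0 : Fin 4 → K), ({0} : Finset (Fin 4)))} (fun bS hbS => ?_) (fun bS hbS bS' hbS' hne => ?_)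
    (Set.finite_empty.subset ?_) (fun b' H hoff => ?_)
  · -- the member `(0, {x₁})`: permissible, hereditary plan conditions, `Acc`
    rw [Finset.mem_singleton] at hbS
    subst hbS
    dsimp only
    rw [hG₀]
    refine ⟨isPermissibleCentre_inst₅, fun q hq => ?_, hacc₀⟩
    rcases hreach q hq with rfl | ⟨c, hc, rfl⟩ <;> dsimp only
    · -- over the 3-fold: the two children
      rw [hleaves s₀ ({0} : Finset (Fin 4))]
      refine ⟨fun e he => ?_, fun e he e' he' hne => ?_, fun l hl => absurd hl (Finset.notMem_empty l),
        fun j' b' hj' hb' _ heq => ?_⟩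
      · obtain ⟨c, hc, rfl⟩ := hmem_plan₀ s₀ he
        refine ⟨Finset.mem_singleton_self _, hent0 c, Finset.singleton_subset_iff.mpr (Finset.mem_insert_self _ _),
          isEquimultiplePoint_inst₅_entry c hc, ?_⟩
        show IsPermissibleCentre p ({0, 1} : Finset (Fin 4))
          (CentreBlowup.step p ({0} : Finset (Fin 4)) 0 (Function.update (0 : Fin 4 → K) 1 c) s₀).F
        rw [step_F_inst₅ c hc]
        exact isPermissibleCentre_child_inst₅ _
      · -- separated at the coordinate `x₂`
        obtain ⟨c, hc, rfl⟩ := hmem_plan₀ s₀ he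
        obtain ⟨c', hc', rfl⟩ := hmem_plan₀ s₀ he'
        refine Or.inl ⟨rfl, 1, Finset.mem_insert_of_mem (Finset.mem_singleton_self _),
          Finset.mem_insert_of_mem (Finset.mem_singleton_self _), ?_⟩
        rw [hent1, hent1]
        exact fun hcc => hne (by rw [hcc])
      · -- cover: an equimultiple pair of the `x₁`-chart agrees with one of the two entries
        rw [Finset.mem_singleton] at hj'
        subst hj'
        have hsq := sq_eq_one_of_isEquimultiplePoint_inst₅ heq
        have key : ∀ c : K, b' 1 = c → ent c ∈ plan s₀ {0} →
            (∃ e ∈ plan s₀ {0}, e.1 = 0 ∧ ∀ i ∈ e.2.2, b' i = e.2.1 i) := fun c hbc hmem =>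
          ⟨ent c, hmem, rfl, fun i hi => by
            rcases Finset.mem_insert.mp hi with rfl | hi
            · rw [hent0]; exact hb'
            · rw [Finset.mem_singleton] at hi
              subst hi
              rw [hent1]; exact hbc⟩
        rcases hsq with h | h
        · exact Or.inl (key 1 h (by rw [hplan₀ s₀]; exact Finset.mem_insert_self _ _))
        · exact Or.inl (key (-1) h (by rw [hplan₀ s₀]; exact Finset.mem_insert_of_mem (Finset.mem_singleton_self _)))
    · -- over a child: nothing is equimultiple
      rw [hplan₁ (CentreBlowup.step p {0} 0 (ent c).2.1 s₀), hleaves (CentreBlowup.step p {0} 0 (ent c).2.1 s₀) {0, 1}]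
      refine ⟨fun e he => absurd he (Finset.notMem_empty e), fun e he => absurd he (Finset.notMem_empty e),
        fun l hl => absurd hl (Finset.notMem_empty l), fun j' b' hj' hb' _ heq => ?_⟩
      exfalso
      refine not_isEquimultiplePoint_child_inst₅ (p := p) ((2 * c) ^ p) (hu c hc) hj' b' hb' ?_
      unfold CentreBlowup.IsEquimultiplePoint CentreBlowup.pointTransform at heq ⊢
      rw [show (CentreBlowup.step p ({0} : Finset (Fin 4)) 0 (ent c).2.1 s₀).F =
        (X 1 ^ (2 * p) + C ((2 * c) ^ p) * X 1 ^ p) * X 2 + X 0 ^ p * X 3 from step_F_inst₅ c hc] at heq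
      exact heq
  · -- one member only
    rw [Finset.mem_singleton] at hbS hbS'
    exact absurd (hbS.trans hbS'.symm) hne
  · -- no root parameter off the member
    rintro b' ⟨H, hoff⟩
    exact hoff ((0 : Fin 4 → K), {0}) (Finset.mem_singleton_self _) (fun i hi => by
      rw [Finset.mem_singleton] at hi; subst hi; exact roots_inst₅ b' H)
  · exfalso
    exact hoff ((0 : Fin 4 → K), {0}) (Finset.mem_singleton_self _) (fun i hi => by
      rw [Finset.mem_singleton] at hi; subst hi; exact roots_inst₅ b' H)

end Instance₅

end Equimultiple

end Summit.ResolutionOfSingularities.ResolutionOfSingularities.Theorems.PIDim4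

end
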